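import Mathlib
import HarnessLib
import Literature.Analysis.FluidPDE.TaoEnstrophyLocalisation
import Literature.Analysis.FluidPDE.HelicityDensityTransport
import Summits.NavierStokesRegularity.NavierStokesRegularity.Theorems.PoloidalWindowDoorPoloidalWindowRigidityWindow
import Summits.NavierStokesRegularity.NavierStokesRegularity.Theorems.PoloidalWindowDoorPoloidalWindowRigidityLeafUniformVortexLine
import Summits.NavierStokesRegularity.NavierStokesRegularity.Theorems.PoloidalWindowDoorPoloidalWindowRigidityLeafUniformRidgeCore

/-!
# Route `PoloidalWindowDoor`, crux `PoloidalWindowRigidity` (stmt-NavierStokesRegularity-19708) — LINE 18 «leaf_uniform»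
# (ns-idea-8 g9, v1.3.1; critic idea-crit-7 g6 PASS; director-ns KEY-NS #190 (3)): the LOAD-BEARING ridge invariant R8
# `RidgeInvariant`, VERBATIM (Cruxes-local `Pinned` / `IsHotArc` / `hotSet` / `lapH` / `hess` unfolded)

Seat ns-es-p1 g7 (free prover hand keyed by director-ns g18, KEY-NS #190 (3); CLAIM announced on the ideators /
ns-regularity-ideate buses before proposing).  `Cruxes/PoloidalWindowRigidity/Lines/leaf_uniform.lean` (v1.3.1) glues the ridge
residue C2a′ of hot_split from structure laws that are UNIFORM ALONG THE HOT VORTEX LEAF; its kernel `cellC2aRidge_of_leaf`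
consumes R8–R11.  Landed here:

* `ridgeInvariant` (R8 `RidgeInvariant`): for a pinned class profile `v` with the frozen law `(ω·∇)v · e₂ ≡ 0` and a hot vortex
  arc `γ : (−ε, ε) → H` (integral curve of `ω(−1,·)` inside the hot set `H = {y₂ = 0, v₂(−1,y) = N}`, `ω(γ 0) ≠ 0`):
  `Δₕv₂(γ τ)·‖ω(γ 0)‖² = Δₕv₂(γ 0)·‖ω(γ τ)‖²` for every `τ ∈ (−ε, ε)` — the ratio `−Δₕv₂/|ω|²` is a LEAF INVARIANT.

PROOF (the line's 3-jet identity, frame-free; `w := v₂(−1,·)`, `ω := curl v(−1,·)`, `Pⱼ := ∂ⱼw`).  Inputs, all PROVED in the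
tree: the class is `IsTypeIAncientMild` (`…Theorems.PoloidalWindowDoorPoloidalWindowRigidityWindow.isTypeIAncientMild_of_class`), so
`w`, `ω` are `C^∞`; `ω₂ ≡ 0` (poloidal); `div ω = 0` (`Literature.Analysis.FluidPDE.divergence_curl_eq_zero_of_contDiffAt`); the
frozen law reads `ω₀P₀ + ω₁P₁ ≡ 0` on `ℝ³`; every hot point is a GLOBAL extremum of `w` (the `Pinned` bound `√(−t)|v₂| ≤ |N|` at
`t = −1`), so `∇w = 0` along the arc; `ω ≠ 0` along the arc by ODE uniqueness from `ω(γ 0) ≠ 0`, the field being globally Lipschitz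
(`…Theorems.PoloidalWindowDoorPoloidalWindowRigidityLeafUniformVortexLine.curl_slice_bounded_lipschitz`, ns-poloidal-K2-p2 g13,
imported by name).  CORE (`…LeafUniformRidgeCore.ridge_core`, pure calculus, split off for the size lint): differentiating `Pⱼ ∘ γ ≡ 0` gives the kernel relations
`ω₀∂₀Pⱼ + ω₁∂₁Pⱼ = 0`; differentiating the frozen law twice in the direction `eᵢ` (`i = 0, 1`; Leibniz, `fderiv2_two_products_apply`)
and evaluating on the arc gives `ω₀∂ᵢ∂ᵢP₀ + ω₁∂ᵢ∂ᵢP₁ = −2(∂ᵢω₀·∂ᵢP₀ + ∂ᵢω₁·∂ᵢP₁)`; by the symmetry of second derivatives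
(`fderiv_dir_comm`, twice) the left side is the derivative of `∂ᵢ∂ᵢw` along the arc; summing `i = 0, 1` and using the kernel
relations, `∂₀ω₀ + ∂₁ω₁ = 0` and `∂₀P₁ = ∂₁P₀`, the 2×2 algebra (`linear_combination`) yields
`(Δₕw ∘ γ)′·|ω ∘ γ|² = (Δₕw ∘ γ)·(|ω ∘ γ|²)′`, so `Δₕw/|ω|²` has zero derivative on `(−ε, ε)` and is constant
(`IsOpen.is_const_of_deriv_eq_zero`).

HONEST LABEL: ONE structure stub (M) of a registered line; it closes no cell, no crux and no route item; R11 `CurtainInvariant` and the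
research cells (MORSE/FLAT × ESCAPING/CAPTURED) are NOT touched; C2a′ / C2b′ / S0, 19708 / 20428 and NS regularity stay OPEN — no
summit statement is proved here.
-/

noncomputable section

-- the summit and its single sub-problem share the name (CONVENTIONS §1), as in every Theorems file
set_option linter.dupNamespace false

namespace Summit.NavierStokesRegularity.NavierStokesRegularity.Theorems.PoloidalWindowDoorPoloidalWindowRigidityLeafUniformRidgeInvariant

open Set Function Filter Topology Metric
open scoped InnerProductSpace RealInnerProductSpace Laplacian NNReal
open Literature.Analysis Literature.Analysis.FluidPDE
open Summit.NavierStokesRegularity.NavierStokesRegularity.Theorems.PoloidalWindowDoorPoloidalWindowRigidityWindow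
open Summit.NavierStokesRegularity.NavierStokesRegularity.Theorems.PoloidalWindowDoorPoloidalWindowRigidityLeafUniformVortexLine
open Summit.NavierStokesRegularity.NavierStokesRegularity.Theorems.PoloidalWindowDoorPoloidalWindowRigidityLeafUniformRidgeCore

/-! ## R8 — the ridge invariant along a hot vortex arc -/

/-- **R8 `RidgeInvariant` (VERBATIM, `Pinned` / `IsHotArc` / `hotSet` / `lapH` / `hess` unfolded): along a hot vortex arc of a pinned
class profile with the frozen law, `Δₕv₂(γ τ)·‖ω(γ 0)‖² = Δₕv₂(γ 0)·‖ω(γ τ)‖²`** — `−Δₕv₂/|ω|²` is constant on the leaf.  Assembly: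
smoothness from the class, `∇v₂(−1,·) = 0` on the hot set (global extremum), the frozen law in coordinates, `ω₂ ≡ 0`, `div ω = 0`,
`ω ≠ 0` along the arc (ODE uniqueness, globally Lipschitz vorticity), then `ridge_core`. -/
theorem ridgeInvariant :
    ∀ (C : ℝ) (v : ℝ → EuclideanSpace ℝ (Fin 3) → EuclideanSpace ℝ (Fin 3)),
      (Literature.Analysis.FluidPDE.HasTypeITimeDecay C v ∧
        ContinuousOn (Function.uncurry v) (Set.Iio (0 : ℝ) ×ˢ Set.univ) ∧
        (∀ s t : ℝ, s < t → t < 0 → ∀ x, v t x =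
          Literature.Analysis.UnboundedOperators.heatExtension (v s) (t - s) x -
            Literature.Analysis.FluidPDE.oseenDuhamel 1 s v v t x) ∧
        (∀ t < 0, Literature.Analysis.FluidPDE.VectorCalculus.IsDivFree (v t)) ∧
        (∀ s < 0, ∀ y, ⟪Literature.Analysis.FluidPDE.curl (v s) y, EuclideanSpace.single 2 1⟫_ℝ = 0) ∧
        v (-1) 0 2 ≠ 0 ∧ (∀ t < 0, ∀ x, Real.sqrt (-t) * |v t x 2| ≤ |v (-1) 0 2|) ∧
        (∀ h : EuclideanSpace ℝ (Fin 3), fderiv ℝ (v (-1)) 0 h 2 = 0) ∧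
        (deriv (fun s => v s 0 2) (-1) = v (-1) 0 2 / 2 ∧ v (-1) 0 2 * (Δ (fun y => v (-1) y 2)) 0 ≤ 0)) →
      (∀ s < 0, ∀ y, ⟪fderiv ℝ (v s) y (Literature.Analysis.FluidPDE.curl (v s) y), EuclideanSpace.single 2 1⟫_ℝ = 0) →
      ∀ (γ : ℝ → EuclideanSpace ℝ (Fin 3)) (ε : ℝ),
        (0 < ε ∧ γ 0 ∈ {y : EuclideanSpace ℝ (Fin 3) | y 2 = 0 ∧ v (-1) y 2 = v (-1) 0 2} ∧
            Literature.Analysis.FluidPDE.curl (v (-1)) (γ 0) ≠ 0 ∧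
            ∀ τ ∈ Set.Ioo (-ε) ε, HasDerivAt γ (Literature.Analysis.FluidPDE.curl (v (-1)) (γ τ)) τ ∧
              γ τ ∈ {y : EuclideanSpace ℝ (Fin 3) | y 2 = 0 ∧ v (-1) y 2 = v (-1) 0 2}) →
        ∀ τ ∈ Set.Ioo (-ε) ε,
          (fderiv ℝ (fun x => fderiv ℝ (fun x' => v (-1) x' 2) x (EuclideanSpace.single 0 1)) (γ τ)
                (EuclideanSpace.single 0 1) +
              fderiv ℝ (fun x => fderiv ℝ (fun x' => v (-1) x' 2) x (EuclideanSpace.single 1 1)) (γ τ)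
                (EuclideanSpace.single 1 1)) *
              ‖Literature.Analysis.FluidPDE.curl (v (-1)) (γ 0)‖ ^ 2 =
            (fderiv ℝ (fun x => fderiv ℝ (fun x' => v (-1) x' 2) x (EuclideanSpace.single 0 1)) (γ 0)
                (EuclideanSpace.single 0 1) +
              fderiv ℝ (fun x => fderiv ℝ (fun x' => v (-1) x' 2) x (EuclideanSpace.single 1 1)) (γ 0)
                (EuclideanSpace.single 1 1)) *
              ‖Literature.Analysis.FluidPDE.curl (v (-1)) (γ τ)‖ ^ 2 := by
  intro C v hP hfrozen γ ε harc τ hτ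
  obtain ⟨hTI, hcont, hmild, hdiv, hpol, -, hbound, -, -⟩ := hP
  obtain ⟨hε, -, hω0, harc'⟩ := harc
  have h0 : (0 : ℝ) ∈ Ioo (-ε) ε := ⟨by linarith, hε⟩
  -- smoothness of the slice, of `w = v₂(−1,·)` and of `ω = curl v(−1,·)`
  have hclass : IsTypeIAncientMild C v := isTypeIAncientMild_of_class hTI hcont hmild hdiv
  have hvinf : ContDiff ℝ ((⊤ : ℕ∞) : WithTop ℕ∞) (v (-1)) := hclass.contDiff_slice (by norm_num)
  have hsm : ∀ n : ℕ, ContDiff ℝ n (v (-1)) := fun n => contDiff_infty.1 hvinf n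
  have hvd : ∀ x, DifferentiableAt ℝ (v (-1)) x := fun x => ((hsm 1).differentiable one_ne_zero) x
  have hw : ∀ n : ℕ, ContDiff ℝ n (fun x => v (-1) x 2) := fun n => contDiff_euclidean.1 (hsm n) 2
  have hωinf : ContDiff ℝ ((⊤ : ℕ∞) : WithTop ℕ∞) (curl (v (-1))) := by
    rw [curl_eq_curlCLM_comp]
    exact curlCLM.contDiff.comp (contDiff_infty_iff_fderiv.1 hvinf).2
  have hωs : ∀ n : ℕ, ContDiff ℝ n (curl (v (-1))) := fun n => contDiff_infty.1 hωinf n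
  have hωd : ∀ x, DifferentiableAt ℝ (curl (v (-1))) x := fun x => ((hωs 1).differentiable one_ne_zero) x
  have hP : ∀ (a : EuclideanSpace ℝ (Fin 3)) (n : ℕ), ContDiff ℝ n (fun x => fderiv ℝ (fun x' => v (-1) x' 2) x a) :=
    fun a n => contDiff_fderiv_apply_dir (n := n) (by exact_mod_cast hw (n + 1)) a
  -- `ω₂ ≡ 0` (poloidal)
  have hω2 : ∀ x, curl (v (-1)) x 2 = 0 := fun x => by
    have h := hpol (-1) (by norm_num) x
    rw [EuclideanSpace.inner_single_right] at h
    simpa using h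
  -- the frozen law in coordinates: `ω₀ ∂₀w + ω₁ ∂₁w ≡ 0`
  have hFro : ∀ x, curl (v (-1)) x 0 * fderiv ℝ (fun x' => v (-1) x' 2) x (EuclideanSpace.single 0 1) +
      curl (v (-1)) x 1 * fderiv ℝ (fun x' => v (-1) x' 2) x (EuclideanSpace.single 1 1) = 0 := fun x => by
    have h := hfrozen (-1) (by norm_num) x
    rw [EuclideanSpace.inner_single_right] at h
    have h' : fderiv ℝ (v (-1)) x (curl (v (-1)) x) 2 = 0 := by simpa using h
    rw [fderiv_apply_coord (hvd x), clm_apply_eq_sum_three, hω2 x, zero_mul, add_zero] at h'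
    exact h'
  -- `div ω = 0` in coordinates, with `∂₂ω₂ = 0`
  have hdivω : ∀ x, fderiv ℝ (fun y => curl (v (-1)) y 0) x (EuclideanSpace.single 0 1) +
      fderiv ℝ (fun y => curl (v (-1)) y 1) x (EuclideanSpace.single 1 1) = 0 := fun x => by
    have h : VectorCalculus.divergence (curl (v (-1))) x = 0 :=
      HelicityDensityTransport.divergence_curl_eq_zero_of_contDiffAt (hsm 2).contDiffAt
    rw [divergence_eq_sum_inner_fderiv (EuclideanSpace.basisFun (Fin 3) ℝ), Fin.sum_univ_three] at h
    simp only [EuclideanSpace.basisFun_apply, EuclideanSpace.inner_single_left, map_one, one_mul] at h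
    rw [fderiv_apply_coord (hωd x) _ 0, fderiv_apply_coord (hωd x) _ 1, fderiv_apply_coord (hωd x) _ 2] at h
    have h2 : fderiv ℝ (fun y => curl (v (-1)) y 2) x (EuclideanSpace.single 2 1) = 0 := by
      rw [show (fun y => curl (v (-1)) y 2) = fun _ => (0 : ℝ) from funext hω2]
      simp
    linarith
  -- `∇w = 0` on the hot set (global extremum of `w` by the pinned bound at `t = −1`)
  have hN1 : ∀ x, |v (-1) x 2| ≤ |v (-1) 0 2| := fun x => by
    have h := hbound (-1) (by norm_num) x
    rwa [neg_neg, Real.sqrt_one, one_mul] at h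
  have hcrit : ∀ t ∈ Ioo (-ε) ε, fderiv ℝ (fun x' => v (-1) x' 2) (γ t) = 0 := by
    intro t ht
    obtain ⟨-, hval⟩ : γ t 2 = 0 ∧ v (-1) (γ t) 2 = v (-1) 0 2 := (harc' t ht).2
    rcases le_or_gt 0 (v (-1) 0 2) with hN | hN
    · have hmax : IsLocalMax (fun x' => v (-1) x' 2) (γ t) :=
        Filter.Eventually.of_forall fun x => by
          show v (-1) x 2 ≤ v (-1) (γ t) 2
          rw [hval]
          exact (le_abs_self _).trans ((hN1 x).trans (abs_of_nonneg hN).le)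
      exact hmax.fderiv_eq_zero
    · have hmin : IsLocalMin (fun x' => v (-1) x' 2) (γ t) :=
        Filter.Eventually.of_forall fun x => by
          show v (-1) (γ t) 2 ≤ v (-1) x 2
          rw [hval]
          have h1 := hN1 x
          rw [abs_of_neg hN] at h1
          linarith [neg_abs_le (v (-1) x 2)]
      exact hmin.fderiv_eq_zero
  have hcritj : ∀ (a : EuclideanSpace ℝ (Fin 3)), ∀ t ∈ Ioo (-ε) ε,
      fderiv ℝ (fun x' => v (-1) x' 2) (γ t) a = 0 := fun a t ht => by
    rw [hcrit t ht]
    rfl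
  -- `ω ≠ 0` along the arc: ODE uniqueness against the constant solution (globally Lipschitz vorticity)
  have hne : ∀ t ∈ Ioo (-ε) ε, curl (v (-1)) (γ t) ≠ 0 := by
    intro t ht hzero
    obtain ⟨K, L, hK, -⟩ := curl_slice_bounded_lipschitz hTI hcont hmild hdiv (s := -1) (by norm_num)
    have huniq := ODE_solution_unique_of_mem_Ioo (v := fun _ => curl (v (-1))) (s := fun _ => (univ : Set _))
      (K := K) (f := γ) (g := fun _ => γ t) (t₀ := t) (fun _ _ => hK.lipschitzOnWith) ht
      (fun s hs => ⟨(harc' s hs).1, mem_univ _⟩)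
      (fun s _ => ⟨by rw [hzero]; exact hasDerivAt_const s (γ t), mem_univ _⟩) rfl
    exact hω0 (by rw [huniq h0]; exact hzero)
  -- the core identity
  exact ridge_core (hP _) (hP _) hωs (fun x => fderiv_dir_comm (hw 2).contDiffAt _ _) hFro hω2 hdivω
    (hcritj _) (hcritj _) (fun t ht => (harc' t ht).1) hne hτ h0


end Summit.NavierStokesRegularity.NavierStokesRegularity.Theorems.PoloidalWindowDoorPoloidalWindowRigidityLeafUniformRidgeInvariant

end
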